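import Mathlib.Data.Nat.Size
import Mathlib.GroupTheory.OrderOfElement
import Mathlib.Algebra.Group.Subgroup.Finite
import Mathlib.Data.ZMod.Basic
import Mathlib.Data.ZMod.QuotientGroup
import Mathlib.Algebra.Field.ZMod
import Mathlib.FieldTheory.Finite.Basic
import Literature.Computability.Cryptography.BlumMicali
import HarnessLib

/-!
# The Blum–Micali reduction (half predicate ⇒ discrete logarithm): deterministic core

Trunk T-CRYPTO (Literature/Computability/Cryptography); groundwork for discharging the named
fact `Literature.Computability.Cryptography.blumMicali_halfPredicate_dlog` (`BlumMicali.lean`, Blum–Micali 1984, Theorem 3),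
triaged XL: the discharge needs (i) a concrete `OracleAlg` implementing the reduction, (ii) its
`IsPolyTime` (TM2 polynomial-time computability of the step function), (iii) the probabilistic
analysis. This file proves, sorry-free, the *mathematical content* of the printed proof that
does not mention machines or coins-as-bit-strings — Blum–Micali's Fact 1, the behaviour of
`B_{p,g}` on the two square roots, the shift lemma, the square-root descent of Lemma 1 with an
arbitrary (possibly faulty) square-root selector, and the exact one-vote count of Lemma 2
("concentrating a stochastic advantage") — in the elementary `ℕ`/`Nat.ModEq` language of
`bmHalfPredicate`, `IsDLogInstance`, `dlogSolutions`.

## Contents (all proved)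

* Indices: `pow_modEq_pow_iff_of_orderOf_eq` (`g^a ≡ g^b ↔ a ≡ b [MOD p-1]`),
  `exists_pow_modEq_of_orderOf_eq` (every unit is `g^a`, `a < p-1`),
  `IsDLogInstance.existsUnique_mem_dlogSolutions` (exactly one discrete logarithm; this proves
  the statement of the named fact `existsUnique_mem_dlogSolutions` of `Shor.lean`).
* Fact 1: `pow_half_eq_neg_one` (`g^{(p-1)/2} = -1`), `sq_modEq_pow_two_mul_iff` (the square
  roots of `g^{2t}` are `g^t`, `g^{t+(p-1)/2}`), `exists_sq_modEq_pow_iff_even` (`g^a` is a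
  square iff `a` is even).
* `B_{p,g}` and principal square roots: `bmHalfPredicate_principal`, `bmHalfPredicate_nonprincipal`,
  `bmHalfPredicate_eq_true_iff_principal` (`B = 1` exactly on the principal root),
  `bmHalfPredicate_mul_pow_shift` (the shift lemma: `B(x g^r) = B(x)` for a square root `x` of
  `g^{2s}`, `1 ≤ s`, `2s + 2r ≤ p - 1`).
* Lemma 1 (descent): `bmRound`, `bmElem`, `bmBit`, `bmIndexOut` (the algorithm of the proof of
  Lemma 1 / Kranakis Thm. 4.18 with a round-indexed selector `sel i`), `BMSelCorrectAt` (the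
  selector of round `i` is right on the one residue it is asked about), and
  `bmElem_modEq`, `bmBit_eq_testBit`, `bmIndexOut_eq_mod`, `bmIndexOut_size_eq`: if the
  selectors of the `< |p|` rounds are right on the residues met, the output is `index_g(y)`.
* Lemma 2 (one vote): `bmVote` (guess the principal root of `e g^{2r}` from the two oracle bits,
  coin on ties, and vote), `bmBitAgreement`, and the counts
  `bmBitAgreement_le_card_bmVote_add` (principal candidate: `#true votes ≥ A - 2c` out of
  `p - 1`), `card_bmVote_nonprincipal_add_le` (non-principal candidate: `#true votes ≤
  (p-1) - (A - 2c)`), where `A` = number of residues on which the bit oracle agrees with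
  `B_{p,g}` and `2c` = index of the residue (`2c ≤ (p-1)/n` on the initial segment).

## What remains for `blumMicali_halfPredicate_dlog_holds` (recorded, not vendored)

(a) Chebyshev for `m` i.i.d. votes each right with probability `≥ 1/2 + η`
(`Pr[#right ≤ m/2] ≤ 1/(4 m η²)`), (b) the union bound over the `< |p|` rounds and the `n`
guesses of the initial segment (Blum–Micali, proof of Theorem 3; Kranakis Thm. 4.19), (c)
sampling `r ∈ [1, (p-1)/2]` from coin bits, (d) the concrete `OracleAlg` (transcript replay) and
(e) its `IsPolyTime` — (e) needs a library of TM2 polynomial-time closure results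
(arithmetic mod `p`, Euler's criterion, square roots via the known non-residue `g`, parsing
`boolPair`), of which the tree has only `PolyTimeComputable.comp_holds`.

## Design notes

* Hypotheses are `p.Prime`, `orderOf (g : ZMod p) = p - 1` (and `p ≠ 2` where parity of
  `p - 1` matters) for the pure algebra, and `IsDLogInstance p g 1` ("`(p, g)` is a valid
  base", as in `bmHalfPredicate_pow`) downstream of `B_{p,g}`.
* Indices of the descent are normalised to `[0, p-1)` (as `dlogSolutions` and Kranakis do), so
  the principal square root of `1` is `1`; Blum–Micali normalise to `[1, p-1]` (principal root
  of `1` is `-1`) and stop the descent at `element = 1`. `bmRound` sends the residue `1` to `1`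
  without consulting the selector, which realises the stop and avoids the boundary case of the
  printed Step 3 → Step 4 (element `g`: divide by `g`, then take "the principal root of `1`").
  On every other residue met the two conventions agree (`bmHalfPredicate_eq_true_iff_principal`
  with `1 ≤ t`).
* `bmRound` tests quadratic residuosity by the (classical) predicate `∃ x, x² ≡ e`; this file is
  specification-level (`noncomputable`, `open scoped Classical` in the descent section). The
  polynomial-time realisations (Euler's criterion, Adleman–Manders–Miller / Tonelli–Shanks
  with the non-residue `g`) belong to step (e) above.
* The bit oracle `β : ℕ → Bool` of the vote section abstracts `bmBitOracle O p g =
  (x ↦ [MB[p,g,x] = encodeBool 1])`; `bmAgreement_le_bmBitAgreement` transfers the hypothesis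
  of the named fact (agreement of the string oracle `O`) to it.

## References

* M. Blum, S. Micali, *How to generate cryptographically strong sequences of pseudo-random
  bits*, SIAM J. Comput. 13 (1984) 850–864, §3.2 (Fact 1), §3.3 (Definition of `B_{p,g}`,
  Remark 1, Lemmas 1–2, Theorem 3). Conference version: FOCS 1982, 112–117
  (doi:10.1109/sfcs.1982.72), pp. 114–116 (same numbering except Theorem 3 = FOCS Theorem 2);
  read from the held FOCS text.
* E. Kranakis, *Primality and Cryptography*, Wiley–Teubner 1986, §1.13 (indices) with
  Thm. 1.11 (Euler's criterion) and Thm. 1.17 (residues = even indices); §4.10 "The index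
  generator" (book pp. 127–132): PQR/NPQR and `B_{p,g}`, Theorem 4.18 (descent), Theorems
  4.19–4.21 (Blum–Micali), Exercises 4.10.2 (shift lemma) and 4.10.3 (dangerous shifts).
-/

noncomputable section

namespace Literature.Computability.Cryptography

open _root_.Computability Complexity

section Generator

variable {p g : ℕ}

/-- For `p` prime and `g` of order `p - 1` modulo `p`, `g` is a unit modulo `p`. [folklore] -/
theorem natCast_ne_zero_of_orderOf_eq (hp : p.Prime) (hord : orderOf (g : ZMod p) = p - 1) :
    (g : ZMod p) ≠ 0 := by
  intro h0
  haveI : Fact p.Prime := ⟨hp⟩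
  rw [h0, orderOf_eq_zero_iff'.2] at hord
  · have := hp.two_le; omega
  · intro n hn h
    exact zero_ne_one ((zero_pow (Nat.pos_iff_ne_zero.1 hn)).symm.trans h)

/-- Powers of a generator agree modulo `p` iff the exponents agree modulo `p - 1`.
[Kranakis 1986, §1.13 (indices); Blum–Micali 1984, §3] [folklore] -/
theorem pow_modEq_pow_iff_of_orderOf_eq (hp : p.Prime) (hord : orderOf (g : ZMod p) = p - 1)
    {a b : ℕ} : g ^ a ≡ g ^ b [MOD p] ↔ a ≡ b [MOD (p - 1)] := by
  haveI : Fact p.Prime := ⟨hp⟩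
  have hgz := natCast_ne_zero_of_orderOf_eq hp hord
  set u : (ZMod p)ˣ := Units.mk0 (g : ZMod p) hgz with hu
  have hordu : orderOf u = p - 1 := by rw [← orderOf_units]; simpa [u] using hord
  rw [← ZMod.natCast_eq_natCast_iff]
  push_cast
  rw [show ((g : ZMod p)) = (u : ZMod p) from rfl, ← Units.val_pow_eq_pow_val,
    ← Units.val_pow_eq_pow_val, Units.val_injective.eq_iff, pow_eq_pow_iff_modEq, hordu]

/-- Every unit modulo `p` is a power `g ^ a`, `a < p - 1`, of a generator `g` (existence of the
index / discrete logarithm). [Kranakis 1986, §1.13 (`Z_p^* = {g^0, …, g^{p-2}}`); Blum–Micali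
1984, §3 (`index_g(y)`)]
[folklore] -/
theorem exists_pow_modEq_of_orderOf_eq (hp : p.Prime) (hord : orderOf (g : ZMod p) = p - 1)
    {y : ℕ} (hy : ¬p ∣ y) : ∃ a, a < p - 1 ∧ g ^ a ≡ y [MOD p] := by
  classical
  haveI : Fact p.Prime := ⟨hp⟩
  have hgz := natCast_ne_zero_of_orderOf_eq hp hord
  have hyz : (y : ZMod p) ≠ 0 := by rwa [Ne, ZMod.natCast_eq_zero_iff]
  set u : (ZMod p)ˣ := Units.mk0 (g : ZMod p) hgz with hu
  set v : (ZMod p)ˣ := Units.mk0 (y : ZMod p) hyz with hv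
  have hordu : orderOf u = p - 1 := by rw [← orderOf_units]; simpa [u] using hord
  have htop : Subgroup.zpowers u = ⊤ := by
    apply Subgroup.eq_top_of_card_eq
    rw [Nat.card_zpowers, hordu, Nat.card_eq_fintype_card, ZMod.card_units]
  have hvmem : v ∈ Subgroup.zpowers u := by rw [htop]; exact Subgroup.mem_top _
  rw [(isOfFinOrder_of_finite u).mem_zpowers_iff_mem_range_orderOf, Finset.mem_image] at hvmem
  obtain ⟨a, ha, hav⟩ := hvmem
  refine ⟨a, by simpa [hordu] using ha, ?_⟩
  rw [← ZMod.natCast_eq_natCast_iff]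
  have := congrArg (fun w : (ZMod p)ˣ => (w : ZMod p)) hav
  simpa [u, v] using this

/-- Uniqueness of the index in `[0, p-1)`. [Kranakis 1986, §1.13 ("the unique `m ≤ p-2`");
Blum–Micali 1984, §3] [folklore] -/
theorem eq_of_pow_modEq_pow_of_lt (hp : p.Prime) (hord : orderOf (g : ZMod p) = p - 1)
    {a b : ℕ} (ha : a < p - 1) (hb : b < p - 1) (h : g ^ a ≡ g ^ b [MOD p]) : a = b := by
  have := (pow_modEq_pow_iff_of_orderOf_eq hp hord).1 h
  rw [Nat.ModEq, Nat.mod_eq_of_lt ha, Nat.mod_eq_of_lt hb] at this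
  exact this

/-- Every discrete-logarithm instance has exactly one solution (this is the named fact
`existsUnique_mem_dlogSolutions` of `Shor.lean`, proved). [Shor 1997, §6; Kranakis 1986,
§1.13] [folklore] -/
theorem IsDLogInstance.existsUnique_mem_dlogSolutions {y : ℕ} (h : IsDLogInstance p g y) :
    ∃! a, a ∈ dlogSolutions p g y := by
  obtain ⟨hp, -, -, hord, hy0, hyp⟩ := h
  have hy : ¬p ∣ y := fun hd => absurd (Nat.le_of_dvd hy0 hd) (not_le.2 hyp)
  obtain ⟨a, ha, hmod⟩ := exists_pow_modEq_of_orderOf_eq hp hord hy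
  refine ⟨a, (mem_dlogSolutions p g y a).2 ⟨ha, hmod⟩, fun b hb => ?_⟩
  have hb' : b < p - 1 ∧ g ^ b ≡ y [MOD p] := hb
  exact eq_of_pow_modEq_pow_of_lt hp hord hb'.1 ha (hb'.2.trans hmod.symm)

/-- For an odd prime `p`, a generator raised to `(p-1)/2` is `-1`. [Kranakis 1986, Thm. 1.11
(Euler's criterion); Blum–Micali 1984, §3.2 Fact 1] [folklore] -/
theorem pow_half_eq_neg_one (hp : p.Prime) (hp2 : p ≠ 2)
    (hord : orderOf (g : ZMod p) = p - 1) : (g : ZMod p) ^ ((p - 1) / 2) = -1 := by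
  haveI : Fact p.Prime := ⟨hp⟩
  obtain ⟨k, hk⟩ := hp.even_sub_one hp2
  have hk' : (p - 1) / 2 = k := by omega
  have hsq : ((g : ZMod p) ^ ((p - 1) / 2)) ^ 2 = 1 := by
    rw [← pow_mul, hk', show k * 2 = p - 1 by omega, ← hord, pow_orderOf_eq_one]
  rcases sq_eq_one_iff_of_ne_zero' hsq with h1 | h1
  · exfalso
    refine pow_ne_one_of_lt_orderOf ?_ ?_ h1
    · have := hp.two_le; omega
    · rw [hord]; have := hp.two_le; omega
  · exact h1
where
  /-- `x ^ 2 = 1 → x = 1 ∨ x = -1` in `ZMod p`. -/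
  sq_eq_one_iff_of_ne_zero' {x : ZMod p} (hx : x ^ 2 = 1) : x = 1 ∨ x = -1 := by
    haveI : Fact p.Prime := ⟨hp⟩
    have h := sq_eq_sq_iff_eq_or_eq_neg (a := x) (b := 1)
    rw [one_pow] at h
    exact h.1 hx

/-- **Fact 1, square roots.** For an odd prime `p` and a generator `g`, the square roots of
`g^{2t}` modulo `p` are exactly `g^t` and `g^{t + (p-1)/2}`. [Blum–Micali 1984, §3.2 Fact 1;
Kranakis 1986, §4.10 (PQR, NPQR)] [cite: BlumMicali1984, §3.2 Fact 1] -/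
theorem sq_modEq_pow_two_mul_iff (hp : p.Prime) (hp2 : p ≠ 2)
    (hord : orderOf (g : ZMod p) = p - 1) {x t : ℕ} :
    x ^ 2 ≡ g ^ (2 * t) [MOD p] ↔ x ≡ g ^ t [MOD p] ∨ x ≡ g ^ (t + (p - 1) / 2) [MOD p] := by
  haveI : Fact p.Prime := ⟨hp⟩
  simp only [← ZMod.natCast_eq_natCast_iff]
  push_cast
  rw [pow_mul', sq_eq_sq_iff_eq_or_eq_neg, pow_add, pow_half_eq_neg_one hp hp2 hord, mul_neg_one]

/-- **Fact 1, quadratic residues.** For an odd prime `p` and a generator `g`, `g^a` is a square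
modulo `p` iff `a` is even. [Blum–Micali 1984, §3.2 Fact 1; Kranakis 1986, Thm. 1.17
(characterization of quadratic residues)] [cite: BlumMicali1984, §3.2 Fact 1] -/
theorem exists_sq_modEq_pow_iff_even (hp : p.Prime) (hp2 : p ≠ 2)
    (hord : orderOf (g : ZMod p) = p - 1) {a : ℕ} :
    (∃ x : ℕ, x ^ 2 ≡ g ^ a [MOD p]) ↔ Even a := by
  haveI : Fact p.Prime := ⟨hp⟩
  have hgz := natCast_ne_zero_of_orderOf_eq hp hord
  constructor
  · rintro ⟨x, hx⟩
    -- `x` is a unit, hence a power of `g`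
    have hxp : ¬p ∣ x := by
      intro hd
      have h0 : (x : ZMod p) = 0 := (ZMod.natCast_eq_zero_iff x p).2 hd
      have := (ZMod.natCast_eq_natCast_iff _ _ _).2 hx
      push_cast at this
      rw [h0, zero_pow two_ne_zero] at this
      exact pow_ne_zero a hgz this.symm
    obtain ⟨b, -, hb⟩ := exists_pow_modEq_of_orderOf_eq hp hord hxp
    have h2 : g ^ (2 * b) ≡ g ^ a [MOD p] := by
      rw [pow_mul']; exact (hb.pow 2).trans hx
    have hmod := (pow_modEq_pow_iff_of_orderOf_eq hp hord).1 h2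
    obtain ⟨k, hk⟩ := hp.even_sub_one hp2
    have hdvd := (Nat.modEq_iff_dvd.1 hmod.symm)
    -- `(p-1) ∣ 2b - a` over `ℤ`, and `2 ∣ p - 1`
    have h2dvd : (2 : ℤ) ∣ ((p - 1 : ℕ) : ℤ) := ⟨k, by rw [hk]; push_cast; ring⟩
    have : (2 : ℤ) ∣ (a : ℤ) := by
      have h := h2dvd.trans hdvd
      have h' : (2 : ℤ) ∣ ((2 * b : ℕ) : ℤ) := ⟨b, by push_cast; ring⟩
      have := (Int.dvd_sub h' h)
      simpa using this
    exact even_iff_two_dvd.2 (by exact_mod_cast this)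
  · rintro ⟨b, rfl⟩
    exact ⟨g ^ b, by rw [← two_mul, pow_mul']⟩

end Generator

/-! ### The predicate `B_{p,g}` on the two square roots, and the shift lemma -/

section HalfPredicate

variable {p g : ℕ}

/-- `B_{p,g}` is `true` on the principal square root `g^t` of `g^{2t}`, `1 ≤ t ≤ (p-1)/2`.
[Blum–Micali 1984, §3.3 (Definition of `B_{p,g}`, Remark 1); Kranakis 1986, §4.10]
[cite: BlumMicali1984, §3.3 Remark 1] -/
theorem bmHalfPredicate_principal (hg : IsDLogInstance p g 1) {t : ℕ} (ht1 : 1 ≤ t)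
    (ht : 2 * t ≤ p - 1) : bmHalfPredicate p g (g ^ t % p) = true := by
  rw [bmHalfPredicate_pow hg ht1 (by omega), decide_eq_true_eq]
  exact ht

/-- `B_{p,g}` is `false` on the non-principal square root `g^{t + (p-1)/2}` of `g^{2t}`,
`1 ≤ t ≤ (p-1)/2`. [Blum–Micali 1984, §3.3 (Definition of `B_{p,g}`, Remark 1); Kranakis 1986,
§4.10] [cite: BlumMicali1984, §3.3 Remark 1] -/
theorem bmHalfPredicate_nonprincipal (hg : IsDLogInstance p g 1) {t : ℕ} (ht1 : 1 ≤ t)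
    (ht : 2 * t ≤ p - 1) : bmHalfPredicate p g (g ^ (t + (p - 1) / 2) % p) = false := by
  rw [bmHalfPredicate_pow hg (by omega) (by omega)]
  simp only [decide_eq_false_iff_not, not_le]
  omega

/-- `B_{p,g}` only depends on the residue of its argument. [folklore] -/
theorem bmHalfPredicate_mod (p g x : ℕ) : bmHalfPredicate p g (x % p) = bmHalfPredicate p g x := by
  simp only [bmHalfPredicate]
  congr 1
  simp only [eq_iff_iff]
  exact exists_congr fun s => and_congr_right fun _ =>
    ⟨fun h => h.trans (Nat.mod_modEq x p), fun h => h.trans (Nat.mod_modEq x p).symm⟩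

/-- `B_{p,g}` respects congruence modulo `p`. [folklore] -/
theorem bmHalfPredicate_congr {x x' : ℕ} (h : x ≡ x' [MOD p]) :
    bmHalfPredicate p g x = bmHalfPredicate p g x' := by
  rw [← bmHalfPredicate_mod p g x, ← bmHalfPredicate_mod p g x', h]

/-- **`B_{p,g}` selects the principal square root.** For an odd prime `p`, a generator `g`,
`1 ≤ t ≤ (p-1)/2` and any square root `x` of `g^{2t}` modulo `p`:
`B_{p,g}(x) = 1` iff `x ≡ g^t`, the principal square root. [Blum–Micali 1984, §3.3 (Definition
of `B_{p,g}`); Kranakis 1986, §4.10 (`B_{p,g}(x) = 1` iff `x = PQR(p,g,x²)`)]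
[cite: BlumMicali1984, §3.3 Definition] -/
theorem bmHalfPredicate_eq_true_iff_principal (hg : IsDLogInstance p g 1) (hp2 : p ≠ 2) {x t : ℕ}
    (ht1 : 1 ≤ t) (ht : 2 * t ≤ p - 1) (hx : x ^ 2 ≡ g ^ (2 * t) [MOD p]) :
    bmHalfPredicate p g x = true ↔ x ≡ g ^ t [MOD p] := by
  have hp := hg.1
  have hord := hg.2.2.2.1
  rcases (sq_modEq_pow_two_mul_iff hp hp2 hord).1 hx with h | h
  · rw [bmHalfPredicate_congr (h.trans (Nat.mod_modEq _ p).symm), bmHalfPredicate_principal hg ht1 ht]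
    exact ⟨fun _ => h, fun _ => rfl⟩
  · rw [bmHalfPredicate_congr (h.trans (Nat.mod_modEq _ p).symm),
      bmHalfPredicate_nonprincipal hg ht1 ht]
    simp only [Bool.false_eq_true, false_iff]
    intro h'
    -- `g^t ≡ g^{t + (p-1)/2}` would force `(p-1) ∣ (p-1)/2`
    have hmod := (pow_modEq_pow_iff_of_orderOf_eq hp hord).1 (h'.symm.trans h)
    have hdvd := (Nat.modEq_iff_dvd' (by omega)).1 hmod
    rw [Nat.add_sub_cancel_left] at hdvd
    have h2 := hp.two_le
    have := Nat.le_of_dvd (by omega) hdvd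
    omega

/-- **The shift lemma** (the "fact" in the proof of Blum–Micali's Lemma 2; Kranakis Exercise
4.10.2). Let `e = g^{2s}` with `1 ≤ s` and let `x` be a square root of `e` modulo `p`. If
`2s + 2r ≤ p - 1` then `x·g^r` is the principal square root of `e·g^{2r}` iff `x` is the
principal square root of `e`; in terms of the predicate, `B_{p,g}(x g^r) = B_{p,g}(x)`.
[Blum–Micali 1984, §3.3, proof of Lemma 2 ("Notice the following fact"); Kranakis 1986, §4.10
Exercise 2] [cite: BlumMicali1984, §3.3 Lemma 2 (proof)] -/
theorem bmHalfPredicate_mul_pow_shift (hg : IsDLogInstance p g 1) (hp2 : p ≠ 2) {x s r : ℕ}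
    (hs1 : 1 ≤ s) (hsr : 2 * (s + r) ≤ p - 1) (hx : x ^ 2 ≡ g ^ (2 * s) [MOD p]) :
    bmHalfPredicate p g (x * g ^ r) = bmHalfPredicate p g x := by
  have hp := hg.1
  have hord := hg.2.2.2.1
  -- `x g^r` is a square root of `g^{2(s+r)}`
  have hx' : (x * g ^ r) ^ 2 ≡ g ^ (2 * (s + r)) [MOD p] := by
    rw [mul_pow, ← pow_mul, mul_add, pow_add, mul_comm r 2]
    exact hx.mul_right _
  rw [Bool.eq_iff_iff, bmHalfPredicate_eq_true_iff_principal hg hp2 (by omega) hsr hx',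
    bmHalfPredicate_eq_true_iff_principal hg hp2 hs1 (by omega) hx, pow_add]
  haveI : Fact p.Prime := ⟨hp⟩
  have hgz := natCast_ne_zero_of_orderOf_eq hp hord
  simp only [← ZMod.natCast_eq_natCast_iff]
  push_cast
  exact mul_left_injective₀ (pow_ne_zero r hgz) |>.eq_iff

end HalfPredicate

/-! ### The square-root descent (Blum–Micali Lemma 1; Kranakis Theorem 4.18) -/

section Descent

open scoped Classical

variable {p g : ℕ}

/-- One round of the square-root descent with square-root selector `sel` (Blum–Micali, proof of
Lemma 1, Steps 2–4; Kranakis, proof of Thm. 4.18, Steps 2–5): read off the parity bit of the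
index of `e` (quadratic-residue test), divide a non-residue by `g`, and replace the resulting
residue `e'` by `sel e'` — intended to be its principal square root — except that the residue
`1` is sent to `1` (its square root of index `0`; this is Kranakis's normalisation of indices to
`[0, p-1)`, matching `dlogSolutions`, and it sidesteps the boundary case `element = 1` of the
printed Step 3 → Step 4). Returns the bit and the next element (a residue in `[0, p)`).
[Blum–Micali 1984, §3.3, proof of Lemma 1; Kranakis 1986, §4.10, proof of Thm. 4.18]
[cite: BlumMicali1984, §3.3 Lemma 1 (proof)] -/
def bmRound (p g : ℕ) (sel : ℕ → ℕ) (e : ℕ) : Bool × ℕ :=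
  let b : Bool := !decide (∃ x : ℕ, x ^ 2 ≡ e [MOD p])
  let e' : ℕ := (if b then e * g ^ (p - 2) else e) % p
  (b, if e' = 1 then 1 else sel e')

/-- The element held after `i` rounds of the descent started at `y`, round `i` using the
selector `sel i` (in the reduction, the majority vote with the `i`-th block of coins).
[Blum–Micali 1984, §3.3, proof of Lemma 1 (the variable `element`)]
[cite: BlumMicali1984, §3.3 Lemma 1 (proof)] -/
def bmElem (p g : ℕ) (sel : ℕ → ℕ → ℕ) (y : ℕ) : ℕ → ℕ
  | 0 => y
  | i + 1 => (bmRound p g (sel i) (bmElem p g sel y i)).2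

/-- The bit produced in round `i` of the descent. [Blum–Micali 1984, §3.3, proof of Lemma 1
(the variable `index`)] [cite: BlumMicali1984, §3.3 Lemma 1 (proof)] -/
def bmBit (p g : ℕ) (sel : ℕ → ℕ → ℕ) (y : ℕ) (i : ℕ) : Bool :=
  (bmRound p g (sel i) (bmElem p g sel y i)).1

/-- The index assembled from the first `k` bits (bit `i` has weight `2^i`: the bits are found
"from right to left"). [Blum–Micali 1984, §3.3, proof of Lemma 1; Kranakis 1986, §4.10, proof
of Thm. 4.18 (output `d`)] [cite: BlumMicali1984, §3.3 Lemma 1 (proof)] -/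
def bmIndexOut (p g : ℕ) (sel : ℕ → ℕ → ℕ) (y : ℕ) : ℕ → ℕ
  | 0 => 0
  | k + 1 => bmIndexOut p g sel y k + if bmBit p g sel y k then 2 ^ k else 0

/-- Correctness requirement on the round-`i` selector along the descent from an element of
index `a`: on the residue `g^{2c} mod p`, `c = ⌊a / 2^{i+1}⌋ ≥ 1`, it returns (a representative
of) the principal square root `g^c`. [Blum–Micali 1984, §3.3, Lemma 1 ("Have MB select the
principal one")] [cite: BlumMicali1984, §3.3 Lemma 1 (proof)] -/
def BMSelCorrectAt (p g : ℕ) (sel : ℕ → ℕ → ℕ) (a i : ℕ) : Prop :=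
  1 ≤ a / 2 ^ (i + 1) → sel i (g ^ (2 * (a / 2 ^ (i + 1))) % p) ≡ g ^ (a / 2 ^ (i + 1)) [MOD p]

/-- The two intermediate quantities of `bmRound` on an element of index `c`: the bit is
the parity of `c`, and the adjusted residue has index `2⌊c/2⌋`. [Blum–Micali 1984, §3.3, proof
of Lemma 1, Steps 2–3; Kranakis 1986, §4.10, Thm. 4.18, Steps 2–4]
[cite: BlumMicali1984, §3.3 Lemma 1 (proof)] -/
theorem bmRound_aux (hg : IsDLogInstance p g 1) (hp2 : p ≠ 2) {e c : ℕ}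
    (he : e ≡ g ^ c [MOD p]) :
    (!decide (∃ x : ℕ, x ^ 2 ≡ e [MOD p])) = decide (c % 2 = 1) ∧
      (if (!decide (∃ x : ℕ, x ^ 2 ≡ e [MOD p])) then e * g ^ (p - 2) else e) % p ≡
        g ^ (2 * (c / 2)) [MOD p] := by
  obtain ⟨hp, -, -, hord, -, -⟩ := hg
  have h2 := hp.two_le
  -- the residue test reads the parity of `c`
  have hqr : (decide (∃ x : ℕ, x ^ 2 ≡ e [MOD p])) = decide (c % 2 = 0) := by
    apply Bool.decide_congr
    rw [← Nat.even_iff, ← exists_sq_modEq_pow_iff_even hp hp2 hord]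
    exact exists_congr fun x => ⟨fun h => h.trans he, fun h => h.trans he.symm⟩
  have hb' : (!decide (∃ x : ℕ, x ^ 2 ≡ e [MOD p])) = decide (c % 2 = 1) := by
    rw [hqr]
    rcases Nat.mod_two_eq_zero_or_one c with h | h <;> simp [h]
  refine ⟨hb', ?_⟩
  rw [hb']
  refine (Nat.mod_modEq _ p).trans ?_
  rcases Nat.mod_two_eq_zero_or_one c with h | h
  · simp only [h, zero_ne_one, decide_false, Bool.false_eq_true, ↓reduceIte]
    rwa [show 2 * (c / 2) = c by omega]
  · simp only [h, decide_true, ↓reduceIte]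
    refine (he.mul_right _).trans ?_
    rw [← pow_add, pow_modEq_pow_iff_of_orderOf_eq hp hord,
      show c + (p - 2) = 2 * (c / 2) + (p - 1) by omega]
    exact Nat.add_modEq_right

/-- One round of the descent on an element of index `c` yields the parity bit of `c` (no
hypothesis on the selector). [Blum–Micali 1984, §3.3, proof of Lemma 1, Step 2;
Kranakis 1986, §4.10, Thm. 4.18, Step 3] [cite: BlumMicali1984, §3.3 Lemma 1 (proof)] -/
theorem bmRound_fst (hg : IsDLogInstance p g 1) (hp2 : p ≠ 2) (sel : ℕ → ℕ) {e c : ℕ}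
    (he : e ≡ g ^ c [MOD p]) :
    (bmRound p g sel e).1 = decide (c % 2 = 1) := by
  simp only [bmRound]
  exact (bmRound_aux hg hp2 he).1

/-- One round of the descent on an element of index `c < p - 1`: if the selector is correct on
`g^{2⌊c/2⌋} mod p` (only asked when `⌊c/2⌋ ≥ 1`), the next element has index `⌊c/2⌋`.
[Blum–Micali 1984, §3.3, proof of Lemma 1, Steps 3–4; Kranakis 1986, §4.10, Thm. 4.18,
Steps 4–5] [cite: BlumMicali1984, §3.3 Lemma 1 (proof)] -/
theorem bmRound_snd (hg : IsDLogInstance p g 1) (hp2 : p ≠ 2) (sel : ℕ → ℕ) {e c : ℕ}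
    (hc : c < p - 1) (he : e ≡ g ^ c [MOD p])
    (hsel : 1 ≤ c / 2 → sel (g ^ (2 * (c / 2)) % p) ≡ g ^ (c / 2) [MOD p]) :
    (bmRound p g sel e).2 ≡ g ^ (c / 2) [MOD p] := by
  obtain ⟨hb', he'c⟩ := bmRound_aux hg hp2 he
  obtain ⟨hp, -, -, hord, -, -⟩ := hg
  have h2 := hp.two_le
  set e' : ℕ := (if (!decide (∃ x : ℕ, x ^ 2 ≡ e [MOD p])) then e * g ^ (p - 2) else e) % p
    with he'
  have hlt : e' < p := Nat.mod_lt _ (by omega)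
  show (if e' = 1 then 1 else sel e') ≡ g ^ (c / 2) [MOD p]
  split_ifs with h1
  · -- `e' = 1` forces `⌊c/2⌋ = 0`
    have h0 : g ^ (2 * (c / 2)) ≡ g ^ 0 [MOD p] := by
      rw [pow_zero, ← h1]; exact he'c.symm
    have := eq_of_pow_modEq_pow_of_lt hp hord (by omega) (by omega) h0
    rw [show c / 2 = 0 by omega, pow_zero]
  · -- otherwise `⌊c/2⌋ ≥ 1` and the selector is applied to `g^{2⌊c/2⌋} mod p`
    have heq : e' = g ^ (2 * (c / 2)) % p := by
      have := he'c; rw [Nat.ModEq, Nat.mod_eq_of_lt hlt] at this; exact this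
    have hc2 : 1 ≤ c / 2 := by
      by_contra h0
      rw [show c / 2 = 0 by omega, mul_zero, pow_zero, Nat.mod_eq_of_lt (show 1 < p by omega)]
        at heq
      exact h1 heq
    rw [heq]
    exact hsel hc2

/-- **Blum–Micali Lemma 1 / Kranakis Theorem 4.18, invariant.** Along the descent from `y` of
index `a`, if the selectors of rounds `< k` are correct on the residues met, then after `k`
rounds the element has index `⌊a / 2^k⌋`. [Blum–Micali 1984, §3.3, proof of Lemma 1
("`index_g(element)` equals the left half of `x`"); Kranakis 1986, §4.10, Thm. 4.18]
[cite: BlumMicali1984, §3.3 Lemma 1 (proof)] -/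
theorem bmElem_modEq {y a : ℕ} (hg : IsDLogInstance p g y) (hp2 : p ≠ 2)
    (ha : a ∈ dlogSolutions p g y) (sel : ℕ → ℕ → ℕ) {k : ℕ}
    (hsel : ∀ i < k, BMSelCorrectAt p g sel a i) :
    bmElem p g sel y k ≡ g ^ (a / 2 ^ k) [MOD p] := by
  have hg1 : IsDLogInstance p g 1 := ⟨hg.1, hg.2.1, hg.2.2.1, hg.2.2.2.1, one_pos, hg.1.one_lt⟩
  induction k with
  | zero => simpa [bmElem] using ((mem_dlogSolutions p g y a).1 ha).2.symm
  | succ k ih =>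
    have ih' := ih fun i hi => hsel i (by omega)
    have hak : a / 2 ^ k < p - 1 :=
      lt_of_le_of_lt (Nat.div_le_self _ _) ((mem_dlogSolutions p g y a).1 ha).1
    have hs : 1 ≤ a / 2 ^ k / 2 →
        sel k (g ^ (2 * (a / 2 ^ k / 2)) % p) ≡ g ^ (a / 2 ^ k / 2) [MOD p] := by
      have := hsel k (by omega)
      rw [BMSelCorrectAt, pow_succ, ← Nat.div_div_eq_div_mul] at this
      exact this
    have := bmRound_snd hg1 hp2 (sel k) hak ih' hs
    rw [bmElem, pow_succ, ← Nat.div_div_eq_div_mul]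
    exact this

/-- **Blum–Micali Lemma 1 / Kranakis Theorem 4.18, the bits.** If the selectors of rounds
`< k` are correct on the residues met, the bit found in round `k` is bit `k` of the index `a`.
[Blum–Micali 1984, §3.3, proof of Lemma 1; Kranakis 1986, §4.10, Thm. 4.18]
[cite: BlumMicali1984, §3.3 Lemma 1 (proof)] -/
theorem bmBit_eq_testBit {y a : ℕ} (hg : IsDLogInstance p g y) (hp2 : p ≠ 2)
    (ha : a ∈ dlogSolutions p g y) (sel : ℕ → ℕ → ℕ) {k : ℕ}
    (hsel : ∀ i < k, BMSelCorrectAt p g sel a i) :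
    bmBit p g sel y k = a.testBit k := by
  have hg1 : IsDLogInstance p g 1 := ⟨hg.1, hg.2.1, hg.2.2.1, hg.2.2.2.1, one_pos, hg.1.one_lt⟩
  rw [bmBit, bmRound_fst hg1 hp2 (sel k) (bmElem_modEq hg hp2 ha sel hsel),
    Nat.testBit_eq_decide_div_mod_eq]

/-- **Blum–Micali Lemma 1 / Kranakis Theorem 4.18, the output.** If the selectors of all
rounds `i` with `i + 1 < k` are correct on the residues met, the index assembled from the first
`k` bits is `a mod 2^k`. [Blum–Micali 1984, §3.3, Lemma 1;
Kranakis 1986, §4.10, Thm. 4.18] [cite: BlumMicali1984, §3.3 Lemma 1] -/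
theorem bmIndexOut_eq_mod {y a : ℕ} (hg : IsDLogInstance p g y) (hp2 : p ≠ 2)
    (ha : a ∈ dlogSolutions p g y) (sel : ℕ → ℕ → ℕ) {k : ℕ}
    (hsel : ∀ i, i + 1 < k → BMSelCorrectAt p g sel a i) :
    bmIndexOut p g sel y k = a % 2 ^ k := by
  induction k with
  | zero => simp [bmIndexOut, Nat.mod_one]
  | succ k ih =>
    rw [bmIndexOut, ih fun i hi => hsel i (by omega),
      bmBit_eq_testBit hg hp2 ha sel fun i hi => hsel i (by omega), Nat.mod_pow_succ,
      Nat.testBit_eq_decide_div_mod_eq]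
    rcases Nat.mod_two_eq_zero_or_one (a / 2 ^ k) with h | h <;> simp [h]

/-- **Blum–Micali Lemma 1 / Kranakis Theorem 4.18.** With `|p|` rounds (`Nat.size p`, the
binary length of `p`) and selectors correct on the (at most `|p| - 1`) residues met, the
descent outputs the discrete logarithm of `y`. In particular (perfect selector) an algorithm
selecting principal square roots yields the index; the reduction feeds it the majority-vote
selector of Lemma 2, correct with probability `1 - δ` per round. [Blum–Micali 1984, §3.3,
Lemma 1; Kranakis 1986, §4.10, Thm. 4.18] [cite: BlumMicali1984, §3.3 Lemma 1] -/
theorem bmIndexOut_size_eq {y a : ℕ} (hg : IsDLogInstance p g y) (hp2 : p ≠ 2)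
    (ha : a ∈ dlogSolutions p g y) (sel : ℕ → ℕ → ℕ)
    (hsel : ∀ i, i + 1 < p.size → BMSelCorrectAt p g sel a i) :
    bmIndexOut p g sel y p.size = a := by
  rw [bmIndexOut_eq_mod hg hp2 ha sel hsel, Nat.mod_eq_of_lt]
  have h1 := ((mem_dlogSolutions p g y a).1 ha).1
  exact lt_of_lt_of_le (by omega) (Nat.lt_size_self p).le

end Descent

/-! ### Concentrating the stochastic advantage: one vote (Blum–Micali Lemma 2) -/

section Vote

variable {p g : ℕ}

/-- The Blum–Micali guess-and-compare vote (proof of Lemma 2). Given a bit oracle `β` on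
residues (the magic box `MB` reduced to bits), a candidate square root `x` of a residue `e`,
a shift `r` and a tie-breaking `coin`: form `e·g^{2r}` with square roots `x·g^r` and
`x·g^{r + (p-1)/2}`, guess its principal square root from the two oracle bits (the root with bit
`1` if the bits differ, a coin flip if they agree), and vote `true` ("`x` is principal") iff the
guess is `x·g^r`. Unfolded: `if β(xg^r) = β(xg^{r+(p-1)/2}) then coin else β(xg^r)`.
[Blum–Micali 1984, §3.3, proof of Lemma 2 (`PSQR_i`, counters `C_X`, `C_Y`); Kranakis 1986,
§4.10, proof of Thm. 4.20 (`PQR^C`, `L'`, `L''`)] [cite: BlumMicali1984, §3.3 Lemma 2 (proof)] -/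
def bmVote (p g : ℕ) (β : ℕ → Bool) (x r : ℕ) (coin : Bool) : Bool :=
  if β (x * g ^ r % p) = β (x * g ^ (r + (p - 1) / 2) % p) then coin else β (x * g ^ r % p)

/-- The number of residues `z ∈ [1, p)` on which the bit oracle `β` agrees with `B_{p,g}`.
[Blum–Micali 1984, §3.3, Theorem 3 (hypothesis: agreement on a `1/2 + ε` fraction)]
[cite: BlumMicali1984, Theorem 3] -/
def bmBitAgreement (p g : ℕ) (β : ℕ → Bool) : ℕ :=
  ((Finset.Ico 1 p).filter fun z => β z = bmHalfPredicate p g z).card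

/-- The bit oracle extracted from a string oracle `O` (the magic box `MB[p, g, ·]`): the answer
on the encoded triple `(p, g, x)` read as the bit "answer = `encodeBool 1`" (any other string,
well-formed or not, reads as `0`). [Blum–Micali 1984, §3.3, Theorem 3 (the oracle `MB`)]
[cite: BlumMicali1984, Theorem 3] -/
def bmBitOracle (O : Oracle) (p g : ℕ) : ℕ → Bool :=
  fun x => decide (O (encodeDLogInstance p g x) = encodeBool true)

/-- The extracted bit oracle agrees with `B_{p,g}` at least wherever `O` answers the correctly
encoded bit, so the hypothesis of `blumMicali_halfPredicate_dlog` (on `bmAgreement O p g`)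
transfers to `bmBitAgreement`. [Blum–Micali 1984, §3.3, Theorem 3 (hypothesis)]
[cite: BlumMicali1984, Theorem 3] -/
theorem bmAgreement_le_bmBitAgreement (O : Oracle) (p g : ℕ) :
    bmAgreement O p g ≤ bmBitAgreement p g (bmBitOracle O p g) := by
  unfold bmAgreement bmBitAgreement bmBitOracle
  refine Finset.card_le_card fun x hx => ?_
  rw [Finset.mem_filter] at hx ⊢
  refine ⟨hx.1, ?_⟩
  rw [hx.2]
  cases bmHalfPredicate p g x <;> decide

/-- Agreement indicator at the residue of index `u`: `1` if `β(g^u) = B_{p,g}(g^u)`, else `0`.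
[Blum–Micali 1984, §3.3, proof of Lemma 2] [cite: BlumMicali1984, §3.3 Lemma 2 (proof)] -/
def bmAgreeAt (p g : ℕ) (β : ℕ → Bool) (u : ℕ) : ℕ :=
  if β (g ^ u % p) = bmHalfPredicate p g (g ^ u % p) then 1 else 0

/-- An agreement indicator is at most `1`. [folklore] -/
theorem bmAgreeAt_le_one (β : ℕ → Bool) (u : ℕ) : bmAgreeAt p g β u ≤ 1 := by
  unfold bmAgreeAt; split_ifs <;> simp

/-- The agreement count is the sum of the agreement indicators over the indices `[1, p-1]`
(`u ↦ g^u mod p` is a bijection `[1, p-1] → ℤ_p^*`). [Blum–Micali 1984, §3.3, proof of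
Lemma 2 ("every even index … can be uniquely written …")] [cite: BlumMicali1984, §3.3 Lemma 2 (proof)] -/
theorem bmBitAgreement_eq_sum (hg : IsDLogInstance p g 1) (β : ℕ → Bool) :
    bmBitAgreement p g β = ∑ u ∈ Finset.Ico 1 p, bmAgreeAt p g β u := by
  obtain ⟨hp, hg0, hgp, hord, -, -⟩ := hg
  have h2 := hp.two_le
  haveI : Fact p.Prime := ⟨hp⟩
  have hgz := natCast_ne_zero_of_orderOf_eq hp hord
  unfold bmBitAgreement bmAgreeAt
  rw [Finset.card_filter]
  symm
  refine Finset.sum_bij (fun u _ => g ^ u % p) (fun u hu => ?_) (fun u₁ hu₁ u₂ hu₂ h => ?_)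
    (fun z hz => ?_) (fun u hu => rfl)
  · -- lands in `[1, p)`
    rw [Finset.mem_Ico]
    refine ⟨Nat.pos_of_ne_zero fun h0 => ?_, Nat.mod_lt _ (by omega)⟩
    exact pow_ne_zero u hgz ((ZMod.natCast_eq_zero_iff _ _).2 (Nat.dvd_of_mod_eq_zero h0) |>
      fun h => by exact_mod_cast h)
  · -- injective on `[1, p-1]`
    rw [Finset.mem_Ico] at hu₁ hu₂
    have hmod : g ^ u₁ ≡ g ^ u₂ [MOD p] := h
    have := (pow_modEq_pow_iff_of_orderOf_eq hp hord).1 hmod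
    -- shift both exponents down by one to land in `[0, p-1)`
    have h' : u₁ - 1 ≡ u₂ - 1 [MOD (p - 1)] := by
      have := Nat.ModEq.add_right_cancel' 1 (show u₁ - 1 + 1 ≡ u₂ - 1 + 1 [MOD (p - 1)] by
        rwa [Nat.sub_add_cancel hu₁.1, Nat.sub_add_cancel hu₂.1])
      exact this
    rw [Nat.ModEq, Nat.mod_eq_of_lt (by omega), Nat.mod_eq_of_lt (by omega)] at h'
    omega
  · -- surjective onto `[1, p)`
    rw [Finset.mem_Ico] at hz
    have hzp : ¬p ∣ z := fun hd => absurd (Nat.le_of_dvd hz.1 hd) (not_le.2 hz.2)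
    obtain ⟨a, ha, hmod⟩ := exists_pow_modEq_of_orderOf_eq hp hord hzp
    rcases Nat.eq_zero_or_pos a with rfl | hapos
    · refine ⟨p - 1, by rw [Finset.mem_Ico]; omega, ?_⟩
      have : g ^ (p - 1) ≡ g ^ 0 [MOD p] :=
        (pow_modEq_pow_iff_of_orderOf_eq hp hord).2 (Nat.modEq_zero_iff_dvd.2 dvd_rfl |>.symm).symm
      rw [Nat.ModEq] at this hmod
      rw [this, hmod, Nat.mod_eq_of_lt hz.2]
    · refine ⟨a, by rw [Finset.mem_Ico]; omega, ?_⟩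
      rw [Nat.ModEq] at hmod
      rw [hmod, Nat.mod_eq_of_lt hz.2]

/-- **One vote, non-dangerous shift.** For the principal square root `x = g^c` (`1 ≤ c`) and a
shift `r` with `c + r ≤ (p-1)/2`, the number of coins making the vote correct is
`[β agrees at g^{c+r}] + [β agrees at g^{c+r+(p-1)/2}]` (both bits right: always; exactly one
right: the coin decides; both wrong: never). Uses the shift lemma. [Blum–Micali 1984, §3.3,
proof of Lemma 2; Kranakis 1986, §4.10, Thm. 4.20 (Cases 1–2) with Exercise 2]
[cite: BlumMicali1984, §3.3 Lemma 2 (proof)] -/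
theorem card_bmVote_principal (hg : IsDLogInstance p g 1) (β : ℕ → Bool) {c r : ℕ}
    (hc1 : 1 ≤ c) (hcr : 2 * (c + r) ≤ p - 1) :
    ((Finset.univ : Finset Bool).filter fun coin => bmVote p g β (g ^ c) r coin).card =
      bmAgreeAt p g β (c + r) + bmAgreeAt p g β (c + r + (p - 1) / 2) := by
  have hB1 : bmHalfPredicate p g (g ^ (c + r) % p) = true :=
    bmHalfPredicate_principal hg (by omega) hcr
  have hB0 : bmHalfPredicate p g (g ^ (c + r + (p - 1) / 2) % p) = false :=
    bmHalfPredicate_nonprincipal hg (by omega) hcr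
  simp only [bmVote, bmAgreeAt, ← pow_add, hB1, hB0, show c + (r + (p - 1) / 2) =
    c + r + (p - 1) / 2 by omega]
  cases β (g ^ (c + r) % p) <;> cases β (g ^ (c + r + (p - 1) / 2) % p) <;> simp
  all_goals decide

/-- **Blum–Micali Lemma 2, one vote (principal candidate).** For an odd prime `p`, a
generator `g`, any bit oracle `β`, and the principal square root `x = g^c` of a residue of
index `2c`, `2 ≤ 2c ≤ p - 1`: over the `p - 1` pairs (shift `r ∈ [1, (p-1)/2]`, coin), the vote
"`x` is principal" is cast at least `A - 2c` times, `A` the number of residues on which `β`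
agrees with `B_{p,g}`. (So for a residue in the initial segment, `2c ≤ (p-1)/n`, and agreement
`A ≥ (1/2 + ε)(p-1)`, a uniformly random vote is correct with probability `≥ 1/2 + ε - 1/n`;
the `2c` term accounts for the "dangerous" shifts `c + r > (p-1)/2`.)
[Blum–Micali 1984, §3.3, Lemma 2 and its proof; Kranakis 1986, §4.10, Thm. 4.20 with
Exercises 2–3] [cite: BlumMicali1984, §3.3 Lemma 2] -/
theorem bmBitAgreement_le_card_bmVote_add (hg : IsDLogInstance p g 1) (hp2 : p ≠ 2)
    (β : ℕ → Bool) {c : ℕ} (hc1 : 1 ≤ c) (hc : 2 * c ≤ p - 1) :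
    bmBitAgreement p g β ≤
      ((Finset.Icc 1 ((p - 1) / 2) ×ˢ (Finset.univ : Finset Bool)).filter
          (fun rc => bmVote p g β (g ^ c) rc.1 rc.2)).card + 2 * c := by
  obtain ⟨k, hk⟩ := hg.1.even_sub_one hp2
  have h2 := hg.1.two_le
  -- notation: `h = (p-1)/2`, `p - 1 = 2h`
  set h := (p - 1) / 2 with hh
  have hph : p = 2 * h + 1 := by omega
  have hch : c ≤ h := by omega
  set f := bmAgreeAt p g β with hf
  have hf1 : ∀ u, f u ≤ 1 := bmAgreeAt_le_one β
  -- Step 1: agreement as a sum over indices `[1, 2h]`, split into four blocks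
  rw [bmBitAgreement_eq_sum hg β, ← hf,
    show Finset.Ico 1 p = Finset.Ico 1 (2 * h + 1) by rw [← hph]]
  have hsplit : ∑ u ∈ Finset.Ico 1 (2 * h + 1), f u =
      (∑ u ∈ Finset.Ico 1 (c + 1), f u + ∑ u ∈ Finset.Ico (c + 1) (h + 1), f u) +
      (∑ u ∈ Finset.Ico (h + 1) (h + c + 1), f u + ∑ u ∈ Finset.Ico (h + c + 1) (2 * h + 1), f u) := by
    rw [Finset.sum_Ico_consecutive _ (by omega) (by omega),
      Finset.sum_Ico_consecutive _ (by omega) (by omega),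
      Finset.sum_Ico_consecutive _ (by omega) (by omega)]
  have hb1 : ∑ u ∈ Finset.Ico 1 (c + 1), f u ≤ c := by
    have := Finset.sum_le_card_nsmul (Finset.Ico 1 (c + 1)) f 1 fun u _ => hf1 u
    simpa using this
  have hb3 : ∑ u ∈ Finset.Ico (h + 1) (h + c + 1), f u ≤ c := by
    have := Finset.sum_le_card_nsmul (Finset.Ico (h + 1) (h + c + 1)) f 1 fun u _ => hf1 u
    simpa using this
  -- Step 2: the two good blocks are the non-dangerous shifts `r ∈ [1, h - c]`
  have hg2 : ∑ u ∈ Finset.Ico (c + 1) (h + 1), f u = ∑ r ∈ Finset.Ico 1 (h - c + 1), f (c + r) := by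
    rw [Finset.sum_Ico_add f 1 (h - c + 1) c, add_comm 1 c, show h - c + 1 + c = h + 1 by omega]
  have hg4 : ∑ u ∈ Finset.Ico (h + c + 1) (2 * h + 1), f u =
      ∑ r ∈ Finset.Ico 1 (h - c + 1), f (c + r + h) := by
    have := Finset.sum_Ico_add f 1 (h - c + 1) (c + h)
    rw [show 1 + (c + h) = h + c + 1 by omega, show h - c + 1 + (c + h) = 2 * h + 1 by omega]
      at this
    rw [← this]
    refine Finset.sum_congr rfl fun r _ => by rw [show c + h + r = c + r + h by omega]
  -- Step 3: the vote count restricted to non-dangerous shifts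
  have hcount : ∑ r ∈ Finset.Ico 1 (h - c + 1), (f (c + r) + f (c + r + h)) ≤
      ((Finset.Icc 1 h ×ˢ (Finset.univ : Finset Bool)).filter
          (fun rc => bmVote p g β (g ^ c) rc.1 rc.2)).card := by
    rw [Finset.card_filter, Finset.sum_product]
    calc ∑ r ∈ Finset.Ico 1 (h - c + 1), (f (c + r) + f (c + r + h))
        = ∑ r ∈ Finset.Ico 1 (h - c + 1),
            ∑ coin ∈ (Finset.univ : Finset Bool),
              (if bmVote p g β (g ^ c) r coin then 1 else 0) := by
          refine Finset.sum_congr rfl fun r hr => ?_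
          rw [Finset.mem_Ico] at hr
          rw [← Finset.card_filter, card_bmVote_principal hg β hc1 (by omega)]
      _ ≤ _ := Finset.sum_le_sum_of_subset fun r hr => by
          rw [Finset.mem_Ico] at hr; rw [Finset.mem_Icc]; omega
  rw [Finset.sum_add_distrib] at hcount
  omega

/-- The vote for the non-principal candidate `x·g^{(p-1)/2}` is the negation of the vote for
`x` with the coin flipped (its two candidate roots are those of `x`, swapped), so its count of
`true` votes is `(p - 1)` minus that of `x`. [Blum–Micali 1984, §3.3, proof of Lemma 2
("Without loss of generality, let `C_X > C_Y`")] [cite: BlumMicali1984, §3.3 Lemma 2 (proof)] -/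
theorem bmVote_mul_pow_half (hg : IsDLogInstance p g 1) (hp2 : p ≠ 2) (β : ℕ → Bool)
    (x r : ℕ) (coin : Bool) :
    bmVote p g β (x * g ^ ((p - 1) / 2)) r coin = !bmVote p g β x r (!coin) := by
  obtain ⟨hp, -, -, hord, -, -⟩ := hg
  obtain ⟨k, hk⟩ := hp.even_sub_one hp2
  -- the second candidate of `x g^h` is `x g^{r + 2h} ≡ x g^r`
  have hwrap : x * g ^ ((p - 1) / 2) * g ^ (r + (p - 1) / 2) % p = x * g ^ r % p := by
    change _ ≡ _ [MOD p]
    rw [mul_assoc, ← pow_add, show (p - 1) / 2 + (r + (p - 1) / 2) = r + (p - 1) by omega]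
    refine Nat.ModEq.mul_left _ ((pow_modEq_pow_iff_of_orderOf_eq hp hord).2 ?_)
    exact Nat.add_modEq_right
  have hswap : x * g ^ ((p - 1) / 2) * g ^ r % p = x * g ^ (r + (p - 1) / 2) % p := by
    rw [mul_assoc, ← pow_add, add_comm]
  simp only [bmVote, hwrap, hswap]
  cases β (x * g ^ r % p) <;> cases β (x * g ^ (r + (p - 1) / 2) % p) <;> cases coin <;> simp

/-- **Blum–Micali Lemma 2, one vote (non-principal candidate).** For the non-principal square
root `x = g^c · g^{(p-1)/2}` of a residue of index `2c`, `2 ≤ 2c ≤ p - 1`, the vote "`x` is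
principal" is cast at most `(p - 1) - (A - 2c)` times over the `p - 1` pairs (shift, coin), `A`
the agreement count of `β` with `B_{p,g}`. [Blum–Micali 1984, §3.3, Lemma 2 and its proof;
Kranakis 1986, §4.10, Thm. 4.20, Case 2] [cite: BlumMicali1984, §3.3 Lemma 2] -/
theorem card_bmVote_nonprincipal_add_le (hg : IsDLogInstance p g 1) (hp2 : p ≠ 2)
    (β : ℕ → Bool) {c : ℕ} (hc1 : 1 ≤ c) (hc : 2 * c ≤ p - 1) :
    ((Finset.Icc 1 ((p - 1) / 2) ×ˢ (Finset.univ : Finset Bool)).filter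
          (fun rc => bmVote p g β (g ^ c * g ^ ((p - 1) / 2)) rc.1 rc.2)).card +
        bmBitAgreement p g β ≤ (p - 1) + 2 * c := by
  have hmain := bmBitAgreement_le_card_bmVote_add hg hp2 β hc1 hc
  obtain ⟨k, hk⟩ := hg.1.even_sub_one hp2
  set S := Finset.Icc 1 ((p - 1) / 2) ×ˢ (Finset.univ : Finset Bool) with hS
  -- votes for the non-principal candidate = failed votes for the principal one, coin flipped
  have hflip : (S.filter fun rc => bmVote p g β (g ^ c * g ^ ((p - 1) / 2)) rc.1 rc.2) =
      (S.filter fun rc => ¬bmVote p g β (g ^ c) rc.1 rc.2 = true).image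
        fun rc => (rc.1, !rc.2) := by
    ext ⟨r, coin⟩
    simp only [Finset.mem_filter, Finset.mem_image, hS, Finset.mem_product, Finset.mem_univ,
      and_true, Prod.mk.injEq, bmVote_mul_pow_half hg hp2, Bool.not_eq_true']
    constructor
    · rintro ⟨hr, hv⟩
      exact ⟨(r, !coin), ⟨hr, by simpa using hv⟩, rfl, by simp⟩
    · rintro ⟨⟨r', coin'⟩, ⟨hr', hv'⟩, rfl, rfl⟩
      exact ⟨hr', by simpa using hv'⟩
  have hinj : Set.InjOn (fun rc : ℕ × Bool => (rc.1, !rc.2))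
      ↑(S.filter fun rc => ¬bmVote p g β (g ^ c) rc.1 rc.2 = true) := by
    rintro ⟨r₁, c₁⟩ - ⟨r₂, c₂⟩ - h
    simp only [Prod.mk.injEq, Bool.not_inj_iff] at h
    rw [h.1, h.2]
  rw [hflip, Finset.card_image_of_injOn hinj]
  have hsum := Finset.card_filter_add_card_filter_not
    (s := S) (fun rc => bmVote p g β (g ^ c) rc.1 rc.2 = true)
  have hcard : S.card = p - 1 := by
    rw [hS, Finset.card_product, Nat.card_Icc, Finset.card_univ, Fintype.card_bool]; omega
  omega

end Vote

end Literature.Computability.Cryptography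

end
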